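import Literature.ModelTheory.ExponentialFields.Wilkie1996SaturationStep
import Literature.ModelTheory.ExponentialFields.OMinimalPolynomiallyBounded
import Literature.ModelTheory.ExponentialFields.Wilkie1996ValuationAlgebraic
import Literature.ModelTheory.Quasiminimal.PregeometryMatroid
import HarnessLib

/-!
# Wilkie 1996, §10 / den Besten, Theorem 7.1.22: the absolute valuation inequality for `T_e` assembled from splitting, the two Claims and the surjectivity step

Topic `Literature/ModelTheory/ExponentialFields`.  `Wilkie1996SaturationStep.lean` reduces the
boundedness leaf `Wilkie1996_expPolynomialPoints_bounded` of Wilkie's theorem to the First Main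
Theorem `hMC : rexpTheory.IsModelComplete` and the **absolute valuation inequality**

> `habs`: for every `M ⊨ T_exp` and `c̄ ∈ Mᵐ`, any `m + 1` non-zero elements of `Dcl_e(c̄)` have a
> non-trivial integer power product in `Fin(M)^×`,

i.e. M. den Besten, *Wilkie's Theorem and the Uniform Real Schanuel Conjecture* (MSc thesis,
Utrecht 2016), **Theorem 7.1.22** ("Suppose that `T_O` is smooth and `K ⊨ T_O`. If `dim(K)` is
finite, then `valdim(K) ≤ dim(K)`") for `T_e` and `K = Dcl_e(c̄)`.  This file **assembles the
printed proof of Theorem 7.1.22 (pp. 82–87)** from the ingredients already in the tree —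
Claim 1 (`OMinimalPolynomiallyBounded.lean`), Theorem 7.1.21 (`OMinimalSplitting.lean`, here
re-proved relative to the definably closed set `K`, as the printed proof applies it to the model
`K` rather than to the ambient structure), Claim 2 (`Wilkie1996ValuationAlgebraic.lean`), the
dimension theory of `Dcl` (`OMinimalPregeometry.lean` with the matroid of
`PregeometryMatroid.lean`), the tower lemma (`Wilkie1996ValRankTower.lean`) — leaving as
hypotheses exactly the two inputs of Theorem 7.2.1 and the analytic core of the proof:

* `hMC` (V1), through which `M | L_e` is o-minimal (`ERestricted.lean`);
* `hS1`: condition `S₁` — every `M | L_e` is polynomially bounded (`IsPolynomiallyBounded`,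
  `OMinimalSplitting.lean`; den Besten, Theorem 7.2.1 from (V2));
* `hsurj`: **the surjectivity step** of the printed proof (pp. 86–89, "it would suffice to show
  that the map `ν_K : k* → V(K)` is surjective … `d ∈ I` and `d > 0` … to finish our proof, it
  would certainly be sufficient to find such points `α, β'₁, …, β'_m` in `k*`"): for `k ⊆ K`
  definably closed in `M`, `a ∈ K` the smallest scale of `K` (positive, infinitesimal, its
  powers coinitial in `K_{>0}`), `R = {b | |b|^q a < 1 ∀ q}` and `I = {b | |b|^{q+1} ≤ a ∃ q}`
  its non-units, `k ⊆ R` cofinal in and splitting `R ∩ K`, generators `C₁, …, C_r ∈ I ∩ K` with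
  `K ⊆ Dcl_e(k ∪ {C̄})`: every non-zero `d ∈ I ∩ K` satisfies `ν(d) = ν(α)` for some `α` that is
  a root of a non-zero polynomial with coefficients in `k[C̄]`.  Its printed proof uses the
  smoothness `S₂` of `T_e` (from `hMC`, (48) of `EPolyNormalForm.lean`), the extreme value
  theorem and Taylor expansion, transferred to `K`; it is not formalized here.

Main results:

* `AbsoluteInequality.exists_elementarySubstructure_splits_subset` — Theorem 7.1.21 inside a
  definably closed set;
* `AbsoluteInequality.exists_subring_scale`, `forall_mul_ne_one_iff_scale` — the convex subring
  `R` of an infinitesimal scale and its maximal ideal `I`;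
* `AbsoluteInequality.exists_generators_of_closed_subset` — bases: a closed `k ⊊ cl(c₁, …, c_m)`
  is `cl` of `m' < m` points, and `r` more generate `cl(c̄)` over `k`, `m' + r ≤ m`;
* `AbsoluteInequality.exists_natCast_abs_le_of_mem_definableClosure_empty` — `Dcl_e(∅)` is
  archimedean (Remark 7.1.5, by transfer from `ℝ`); `isVUnit_of_mem_definableClosure_empty`;
* `AbsoluteInequality.exists_isVUnit_rel_of_algebraic` — Claim 2 for roots of polynomials over
  `k[C̄]`;
* `AbsoluteInequality.absolute_of_surjectivity` — **`habs` from `hMC`, `hS1`, `hsurj`**;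
* `Wilkie1996_expPolynomialPoints_bounded_of_surjectivity`, `wilkie_isModelComplete_of_surjectivity`,
  `Wilkie1996_realExp_modelsExistentiallyClosed_of_surjectivity`,
  `Wilkie1996_expPolynomial_transfer_of_surjectivity`, `wilkie_isOMinimal_of_surjectivity` —
  the leaf, Wilkie's theorem and its corollaries from `hMC`, `hS1`, `hsurj`.

Nothing here is a named fact; no definition is introduced.

## References

* M. den Besten, *Wilkie's Theorem and the Uniform Real Schanuel Conjecture*, MSc thesis, Utrecht
  (2016): Theorem 7.1.21, Theorem 7.1.22 with Claims 1–2 (pp. 81–89), Remark 7.1.5,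
  Lemma 7.1.13, Theorem 7.2.1. [DenBesten2016]
* A. J. Wilkie, *Model completeness results for expansions of the ordered field of real numbers by
  restricted Pfaffian functions and the exponential function*, J. Amer. Math. Soc. 9 (1996),
  1051–1094, §10 (Theorems 10.3–10.4, Lemma 10.5). [WilkieJAMS1996]
-/

noncomputable section

open Set FirstOrder FirstOrder.Language FirstOrder.Language.Structure

namespace Literature.ModelTheory.ExponentialFields

namespace AbsoluteInequality

/-! ### Theorem 7.1.21 relative to a definably closed set -/

section OrderedField

variable {L : FirstOrder.Language.{0, 0}} {M : Type*} [L.Structure M] [Field M] [LinearOrder M]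
  [IsStrictOrderedRing M] (φ : Language.orderedRing →ᴸ L) [φ.IsExpansionOn M]

include φ

open OrderedFieldExpansion in
/-- **Splitting inside a definably closed set** (den Besten 2016, Theorem 7.1.21, applied — as in
the proof of Theorem 7.1.22 — to the model `K = Dcl(c̄) ≼ M` rather than to `M`; here `K` is any
definably closed subset of a polynomially bounded o-minimal expansion `M` of an ordered field, and
"elementary substructure of `K`" becomes "elementary substructure of `M` contained in `K`").
Let `R` be a convex subring of `M` and `S ⊆ R ∩ K` an elementary substructure of `M`.  Then
there is an elementary substructure `T` of `M` with `S ⊆ T ⊆ R ∩ K`, cofinal in `R ∩ K`, such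
that every `a ∈ R ∩ K` differs from some `b ∈ T` by a non-unit of `R`.  The proof is that of
`OMinimalSplitting.lean` (`exists_elementarySubstructure_splits`: Zorn's lemma on the subsets of
`R` meeting every non-empty set definable over them, cofinality by polynomial bounds, splitting by
the monotonicity theorem) with the extra constraint `⊆ K`, harmless because `Dcl(T ∪ {a}) ⊆ K`
for `a ∈ K`. [cite: DenBesten2016, Theorem 7.1.21 and proof of Theorem 7.1.22] -/
theorem exists_elementarySubstructure_splits_subset (hO : L.IsOMinimal M)
    (hpb : IsPolynomiallyBounded L M) (K : Set M) (hK : definableClosure L K = K)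
    (R : Subring M) (hR : (R : Set M).OrdConnected)
    (S : L.ElementarySubstructure M) (hSR : (S : Set M) ⊆ R) (hSK : (S : Set M) ⊆ K) :
    ∃ T : L.ElementarySubstructure M, (S : Set M) ⊆ T ∧ (T : Set M) ⊆ R ∧ (T : Set M) ⊆ K ∧
      (∀ a ∈ R, a ∈ K → ∃ α ∈ T, a < α) ∧
      ∀ a ∈ R, a ∈ K → ∃ b ∈ T, ∀ r ∈ R, (a - b) * r ≠ 1 := by
  classical
  -- `K` is closed under the field operations
  have hKof : ∀ {x : M}, x ∈ definableClosure L K → x ∈ K := fun hx => by rwa [hK] at hx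
  have hKneg : ∀ x ∈ K, -x ∈ K := fun x hx =>
    hKof (neg_mem_definableClosure φ (subset_definableClosure K hx))
  have hKsub : ∀ x ∈ K, ∀ y ∈ K, x - y ∈ K := fun x hx y hy =>
    hKof (sub_mem_definableClosure φ (subset_definableClosure K hx) (subset_definableClosure K hy))
  have hKinv : ∀ x ∈ K, x⁻¹ ∈ K := fun x hx =>
    hKof (inv_mem_definableClosure φ (subset_definableClosure K hx))
  -- Zorn's lemma on the subsets of `R ∩ K` meeting every non-empty set definable over them
  set 𝒮 : Set (Set M) := {A | L.MeetsDefinable A ∧ A ⊆ R ∧ A ⊆ K} with h𝒮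
  have hchain : ∀ c ⊆ 𝒮, IsChain (· ⊆ ·) c → c.Nonempty → ∃ ub ∈ 𝒮, ∀ s ∈ c, s ⊆ ub := by
    intro c hc hch hne
    exact ⟨⋃₀ c, ⟨meetsDefinable_sUnion_of_isChain hch hne fun s hs => (hc hs).1,
      sUnion_subset fun s hs => (hc hs).2.1, sUnion_subset fun s hs => (hc hs).2.2⟩,
      fun s hs => subset_sUnion_of_mem hs⟩
  obtain ⟨A, hSA, hAmax⟩ :=
    zorn_subset_nonempty 𝒮 hchain (S : Set M) ⟨S.meetsDefinable, hSR, hSK⟩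
  have hAmeet : L.MeetsDefinable A := hAmax.1.1
  have hAR : A ⊆ R := hAmax.1.2.1
  have hAK : A ⊆ K := hAmax.1.2.2
  have hmax : ∀ B ∈ 𝒮, A ⊆ B → B ⊆ A := fun B hB hAB => hAmax.2 hB hAB
  -- `A` is `dcl`-closed, hence closed under the field operations and definable functions
  have hdcl : definableClosure L A = A := definableClosure_eq_of_meetsDefinable hAmeet
  have hofdcl : ∀ {B : Set M} {x : M}, B ⊆ A → x ∈ definableClosure L B → x ∈ A := by
    intro B x hB hx
    rw [← hdcl]
    exact definableClosure_mono hB hx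
  have hadd1 : ∀ x ∈ A, x + 1 ∈ A := fun x hx =>
    hofdcl (singleton_subset_iff.2 hx) (add_one_mem_definableClosure φ x)
  have hneg : ∀ x ∈ A, -x ∈ A := fun x hx =>
    hofdcl Subset.rfl (neg_mem_definableClosure φ (subset_definableClosure A hx))
  have hinv : ∀ x ∈ A, x⁻¹ ∈ A := fun x hx =>
    hofdcl Subset.rfl (inv_mem_definableClosure φ (subset_definableClosure A hx))
  have hadd : ∀ x ∈ A, ∀ y ∈ A, x + y ∈ A := fun x hx y hy =>
    hofdcl Subset.rfl (add_mem_definableClosure φ (subset_definableClosure A hx)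
      (subset_definableClosure A hy))
  have hsub : ∀ x ∈ A, ∀ y ∈ A, x - y ∈ A := fun x hx y hy =>
    hofdcl Subset.rfl (sub_mem_definableClosure φ (subset_definableClosure A hx)
      (subset_definableClosure A hy))
  have happly : ∀ {g : M → M}, A.Definable L {v : Fin 2 → M | v 1 = g (v 0)} →
      ∀ x ∈ A, g x ∈ A := fun hg x hx =>
    hofdcl Subset.rfl (apply_mem_definableClosure hg (subset_definableClosure A hx))
  -- maximality: adjoining a point of `K` outside `A` produces an element outside `R`
  have hext : ∀ a ∈ K, a ∉ A → ∃ y ∈ definableClosure L (insert a A), y ∉ R := by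
    intro a haK haA
    by_contra hcon
    push Not at hcon
    have helem := isElementary_definableClosureSubstructure_of_orderedField φ hO (insert a A)
    have hmeet' : L.MeetsDefinable (definableClosure L (insert a A)) :=
      ElementarySubstructure.meetsDefinable ⟨_, helem⟩
    have hsubK : definableClosure L (insert a A) ⊆ K := by
      rw [← hK]
      exact definableClosure_mono (insert_subset haK hAK)
    have hge := hmax _ ⟨hmeet', hcon, hsubK⟩
      ((subset_insert a A).trans (subset_definableClosure _))
    exact haA (hge (subset_definableClosure _ (mem_insert a A)))
  have hltA : A.Definable L {v : Fin 2 → M | v 0 < v 1} := definable_lt φ A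
  -- Claim: `A` is cofinal in `R ∩ K` (polynomial boundedness)
  have hcof : ∀ a ∈ R, a ∈ K → ∃ α ∈ A, a < α := by
    intro a haR haK
    by_contra hcon
    push Not at hcon
    have haA : a ∉ A := fun haA => not_le.2 (lt_add_one a) (hcon _ (hadd1 a haA))
    obtain ⟨y, hy, hyR⟩ := hext a haK haA
    obtain ⟨g, hg, hga⟩ := exists_fun_of_mem_definableClosure_insert hy
    obtain ⟨N, b₀, hb₀⟩ := hpb g (hg.mono (subset_univ A))
    -- the set of thresholds is `A`-definable and non-empty, hence meets `A`
    have hTdef : A.Definable₁ L {b : M | ∀ x, b < x → |g x| ≤ x ^ N} := by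
      show A.Definable L {v : Fin 1 → M | ∀ x, v 0 < x → |g x| ≤ x ^ N}
      apply definable_setOf_forall_params
      apply definable_setOf_imp_params
      · exact definable_setOf_lt_params hltA (definableFun_proj_params _)
          (definableFun_proj_params _)
      · have h1 : A.Definable L {w : Fin 1 ⊕ Unit → M |
            -(w (Sum.inr ()) ^ N) ≤ g (w (Sum.inr ())) ∧
              g (w (Sum.inr ())) ≤ w (Sum.inr ()) ^ N} := by
          apply definable_setOf_and_params
          · exact definable_setOf_le_params hltA
              (definableFun_neg φ (definableFun_pow φ (definableFun_proj_params _) N))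
              (definableFun_apply_params hg (definableFun_proj_params _))
          · exact definable_setOf_le_params hltA
              (definableFun_apply_params hg (definableFun_proj_params _))
              (definableFun_pow φ (definableFun_proj_params _) N)
        refine (congrArg _ ?_).mpr h1
        ext w
        simp only [mem_setOf_eq]
        exact abs_le
    obtain ⟨b, hbT, hbA⟩ := hAmeet {b : M | ∀ x, b < x → |g x| ≤ x ^ N} ⟨b₀, hb₀⟩ hTdef
    have hba : b < a := lt_of_le_of_ne (hcon b hbA) fun h => haA (h ▸ hbA)
    have hbound : |y| ≤ a ^ N := hga ▸ hbT a hba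
    have hpow : a ^ N ∈ R := R.pow_mem haR N
    exact hyR (hR.out (R.neg_mem hpow) hpow ⟨(abs_le.1 hbound).1, (abs_le.1 hbound).2⟩)
  -- and coinitial
  have hcoi : ∀ a ∈ R, a ∈ K → ∃ α ∈ A, α < a := fun a haR haK => by
    obtain ⟨α, hαA, hα⟩ := hcof (-a) (R.neg_mem haR) (hKneg a haK)
    exact ⟨-α, hneg α hαA, by linarith⟩
  -- Splitting: every `a ∈ R ∩ K` is congruent to an element of `A` modulo the maximal ideal
  have hsplit : ∀ a ∈ R, a ∈ K → ∃ b ∈ A, ∀ r ∈ R, (a - b) * r ≠ 1 := by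
    intro a haR haK
    by_contra hcon
    push Not at hcon
    have haA : a ∉ A := fun haA => by
      obtain ⟨r, _, hr⟩ := hcon a haA
      rw [sub_self, zero_mul] at hr
      exact zero_ne_one hr
    obtain ⟨y, hy, hyR⟩ := hext a haK haA
    obtain ⟨g, hg, hga⟩ := exists_fun_of_mem_definableClosure_insert hy
    obtain ⟨F, hFdcl, hmono⟩ := monotonicity_params hO (definable_lt_empty_of_expansion φ) hg
    have hFA : ∀ z ∈ F, z ∈ A := fun z hz => by
      rw [← hdcl]
      exact hFdcl (Finset.mem_coe.2 hz)
    -- `c, d ∈ A` with `c < a < d` and no breakpoint of `g` strictly between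
    obtain ⟨αl, hαlA, hαl⟩ := hcoi a haR haK
    obtain ⟨αu, hαuA, hαu⟩ := hcof a haR haK
    set c : M := (insert αl (F.filter (· < a))).max' (Finset.insert_nonempty _ _) with hc
    set d : M := (insert αu (F.filter (a < ·))).min' (Finset.insert_nonempty _ _) with hd
    have hca : c < a := by
      refine (Finset.max'_lt_iff _ _).2 fun z hz => ?_
      rcases Finset.mem_insert.1 hz with rfl | hz
      · exact hαl
      · exact (Finset.mem_filter.1 hz).2
    have had : a < d := by
      refine (Finset.lt_min'_iff _ _).2 fun z hz => ?_
      rcases Finset.mem_insert.1 hz with rfl | hz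
      · exact hαu
      · exact (Finset.mem_filter.1 hz).2
    have hcA : c ∈ A := by
      have hmem := Finset.max'_mem (insert αl (F.filter (· < a))) (Finset.insert_nonempty _ _)
      rcases Finset.mem_insert.1 hmem with h | h
      · rw [hc, h]; exact hαlA
      · exact hFA _ (Finset.mem_filter.1 h).1
    have hdA : d ∈ A := by
      have hmem := Finset.min'_mem (insert αu (F.filter (a < ·))) (Finset.insert_nonempty _ _)
      rcases Finset.mem_insert.1 hmem with h | h
      · rw [hd, h]; exact hαuA
      · exact hFA _ (Finset.mem_filter.1 h).1
    have hFout : ∀ z ∈ F, z ∉ Ioo c d := by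
      intro z hz hzcd
      have hza : z ≠ a := fun h => haA (h ▸ hFA z hz)
      rcases lt_or_gt_of_ne hza with hlt | hgt
      · have hle : z ≤ c :=
          Finset.le_max' _ _ (Finset.mem_insert_of_mem (Finset.mem_filter.2 ⟨hz, hlt⟩))
        exact not_lt.2 hle hzcd.1
      · have hle : d ≤ z :=
          Finset.min'_le _ _ (Finset.mem_insert_of_mem (Finset.mem_filter.2 ⟨hz, hgt⟩))
        exact not_lt.2 hle hzcd.2
    -- `a - c` and `d - a` are units of `R`; choose `e ∈ A` above their inverses
    obtain ⟨r₁, hr₁R, hr₁⟩ := hcon c hcA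
    obtain ⟨r₂, hr₂R, hr₂⟩ := hcon d hdA
    have hac : 0 < a - c := sub_pos.2 hca
    have hda : 0 < d - a := sub_pos.2 had
    have hr₁pos : 0 < r₁ := pos_of_mul_pos_right (hr₁.symm ▸ one_pos) hac.le
    have hr₂' : (d - a) * (-r₂) = 1 := by rw [← hr₂]; ring
    have hr₂pos : 0 < -r₂ := pos_of_mul_pos_right (hr₂'.symm ▸ one_pos) hda.le
    have hr₁eq : r₁ = (a - c)⁻¹ := eq_inv_of_mul_eq_one_right hr₁
    have hr₂eq : -r₂ = (d - a)⁻¹ := eq_inv_of_mul_eq_one_right hr₂'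
    have hr₁K : r₁ ∈ K := hr₁eq ▸ hKinv _ (hKsub a haK c (hAK hcA))
    have hr₂K : -r₂ ∈ K := hr₂eq ▸ hKinv _ (hKsub d (hAK hdA) a haK)
    obtain ⟨e₁, he₁A, he₁⟩ := hcof r₁ hr₁R hr₁K
    obtain ⟨e₂, he₂A, he₂⟩ := hcof (-r₂) (R.neg_mem hr₂R) hr₂K
    have heA : max e₁ e₂ ∈ A := by
      rcases le_total e₁ e₂ with h | h
      · rw [max_eq_right h]; exact he₂A
      · rw [max_eq_left h]; exact he₁A
    set e := max e₁ e₂ with he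
    have hepos : 0 < e := (hr₁pos.trans he₁).trans_le (le_max_left _ _)
    have heinv : 0 < e⁻¹ := inv_pos.2 hepos
    have hp : c + e⁻¹ < a := by
      have h1 : e⁻¹ < r₁⁻¹ := (inv_lt_inv₀ hepos hr₁pos).2 (he₁.trans_le (le_max_left _ _))
      have h2 : a - c = r₁⁻¹ := eq_inv_of_mul_eq_one_left hr₁
      linarith
    have hq : a < d - e⁻¹ := by
      have h1 : e⁻¹ < (-r₂)⁻¹ := (inv_lt_inv₀ hepos hr₂pos).2 (he₂.trans_le (le_max_right _ _))
      have h2 : d - a = (-r₂)⁻¹ := eq_inv_of_mul_eq_one_left hr₂'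
      linarith
    have hpA : c + e⁻¹ ∈ A := hadd _ hcA _ (hinv _ heA)
    have hqA : d - e⁻¹ ∈ A := hsub _ hdA _ (hinv _ heA)
    have hcp : c < c + e⁻¹ := lt_add_of_pos_right _ heinv
    have hqd : d - e⁻¹ < d := sub_lt_self _ heinv
    have hgp : g (c + e⁻¹) ∈ R := hAR (happly hg _ hpA)
    have hgq : g (d - e⁻¹) ∈ R := hAR (happly hg _ hqA)
    apply hyR
    rw [← hga]
    rcases hmono c d hFout with hconst | ⟨hsm | hsa, -⟩
    · rw [hconst a ⟨hca, had⟩ (c + e⁻¹) ⟨hcp, hp.trans had⟩]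
      exact hgp
    · have h1 : g (c + e⁻¹) < g a := hsm ⟨hcp, hp.trans had⟩ ⟨hca, had⟩ hp
      have h2 : g a < g (d - e⁻¹) := hsm ⟨hca, had⟩ ⟨hca.trans hq, hqd⟩ hq
      exact hR.out hgp hgq ⟨h1.le, h2.le⟩
    · have h1 : g a < g (c + e⁻¹) := hsa ⟨hcp, hp.trans had⟩ ⟨hca, had⟩ hp
      have h2 : g (d - e⁻¹) < g a := hsa ⟨hca, had⟩ ⟨hca.trans hq, hqd⟩ hq
      exact hR.out hgq hgp ⟨h2.le, h1.le⟩
  -- assemble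
  refine ⟨hAmeet.toElementarySubstructure, ?_, ?_, ?_, ?_, ?_⟩
  · rw [coe_toElementarySubstructure_of_meetsDefinable]
    exact hSA
  · rw [coe_toElementarySubstructure_of_meetsDefinable]
    exact hAR
  · rw [coe_toElementarySubstructure_of_meetsDefinable]
    exact hAK
  · intro a haR haK
    obtain ⟨α, hαA, hα⟩ := hcof a haR haK
    refine ⟨α, ?_, hα⟩
    rw [← SetLike.mem_coe, coe_toElementarySubstructure_of_meetsDefinable]
    exact hαA
  · intro a haR haK
    obtain ⟨b, hbA, hb⟩ := hsplit a haR haK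
    refine ⟨b, ?_, hb⟩
    rw [← SetLike.mem_coe, coe_toElementarySubstructure_of_meetsDefinable]
    exact hbA

end OrderedField

/-! ### The convex subring attached to an infinitesimal scale -/

section Scale

variable {M : Type*} [Field M] [LinearOrder M] [IsStrictOrderedRing M]

/-- For `0 < a` infinitesimal, `R_a = {b | |b|^q · a < 1 for all q}` (den Besten's
`R = {b | |b| < a^{-1/m} for all m}`, proof of Theorem 7.1.22) is a subring.
[cite: DenBesten2016, Theorem 7.1.22] -/
theorem exists_subring_scale {a : M} (ha : 0 < a) (hainf : ∀ n : ℕ, (n : M) * a < 1) :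
    ∃ R : Subring M, (∀ b, b ∈ R ↔ ∀ q : ℕ, |b| ^ q * a < 1) ∧ (R : Set M).OrdConnected := by
  have ha1 : a < 1 := by simpa using hainf 1
  -- membership predicate
  have hmul : ∀ b c : M, (∀ q : ℕ, |b| ^ q * a < 1) → (∀ q : ℕ, |c| ^ q * a < 1) →
      ∀ q : ℕ, |b * c| ^ q * a < 1 := by
    intro b c hb hc q
    have hb2 := hb (2 * q)
    have hc2 := hc (2 * q)
    -- `(|bc|^q a)^2 = (|b|^{2q} a)(|c|^{2q} a) < 1`
    have hsq : (|b * c| ^ q * a) ^ 2 < 1 := by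
      have h : (|b * c| ^ q * a) ^ 2 = (|b| ^ (2 * q) * a) * (|c| ^ (2 * q) * a) := by
        rw [abs_mul, mul_pow, pow_mul, pow_mul]; ring
      rw [h]
      have h0b : 0 ≤ |b| ^ (2 * q) * a := mul_nonneg (pow_nonneg (abs_nonneg _) _) ha.le
      calc (|b| ^ (2 * q) * a) * (|c| ^ (2 * q) * a) < 1 * 1 :=
            mul_lt_mul'' hb2 hc2 h0b (mul_nonneg (pow_nonneg (abs_nonneg _) _) ha.le)
        _ = 1 := one_mul 1
    have h0 : 0 ≤ |b * c| ^ q * a := mul_nonneg (pow_nonneg (abs_nonneg _) _) ha.le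
    nlinarith [hsq, h0]
  have htwo : ∀ q : ℕ, |(2 : M)| ^ q * a < 1 := by
    intro q
    rw [abs_of_pos (by norm_num : (0 : M) < 2)]
    have h := hainf (2 ^ q)
    push_cast at h
    exact h
  have hle : ∀ b c : M, |b| ≤ |c| → (∀ q : ℕ, |c| ^ q * a < 1) → ∀ q : ℕ, |b| ^ q * a < 1 := by
    intro b c hbc hc q
    calc |b| ^ q * a ≤ |c| ^ q * a := by gcongr
      _ < 1 := hc q
  have hadd : ∀ b c : M, (∀ q : ℕ, |b| ^ q * a < 1) → (∀ q : ℕ, |c| ^ q * a < 1) →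
      ∀ q : ℕ, |b + c| ^ q * a < 1 := by
    intro b c hb hc
    -- `|b + c| ≤ |2 · max(|b|,|c|)|`
    have hm : ∀ q : ℕ, abs (max |b| |c|) ^ q * a < 1 := by
      intro q
      rw [abs_of_nonneg (le_max_of_le_left (abs_nonneg b))]
      rcases le_total |b| |c| with h | h
      · rw [max_eq_right h]; exact hc q
      · rw [max_eq_left h]; exact hb q
    refine hle (b + c) (2 * max |b| |c|) ?_ (hmul 2 _ htwo hm)
    rw [abs_mul, abs_of_pos (by norm_num : (0 : M) < 2),
      abs_of_nonneg (le_max_of_le_left (abs_nonneg b))]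
    calc |b + c| ≤ |b| + |c| := abs_add_le b c
      _ ≤ 2 * max |b| |c| := by
        rcases le_total |b| |c| with h | h
        · rw [max_eq_right h]; linarith
        · rw [max_eq_left h]; linarith
  refine ⟨{ carrier := {b | ∀ q : ℕ, |b| ^ q * a < 1}
            mul_mem' := fun {b c} hb hc => hmul b c hb hc
            one_mem' := fun q => by simpa using ha1
            add_mem' := fun {b c} hb hc => hadd b c hb hc
            zero_mem' := fun q => by
              cases q with
              | zero => simpa using ha1
              | succ q => simp
            neg_mem' := fun {b} hb q => by simpa [abs_neg] using hb q }, fun b => Iff.rfl, ?_⟩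
  refine ⟨fun x hx z hz y hy => ?_⟩
  have hxz : |y| ≤ max |x| |z| := abs_le_max_abs_abs hy.1 hy.2
  rcases le_total |x| |z| with h | h
  · rw [max_eq_right h] at hxz
    exact hle y z hxz hz
  · rw [max_eq_left h] at hxz
    exact hle y x hxz hx

/-- The non-units of `R_a` are the elements of `I_a = {b | |b|^{q+1} ≤ a for some q}` (den
Besten's maximal ideal `I`: `b⁻¹ ∉ R` iff `|b⁻¹|^m ≥ a⁻¹` for some `m ≥ 1`).
[cite: DenBesten2016, Theorem 7.1.22] -/
theorem forall_mul_ne_one_iff_scale {a : M} (ha : 0 < a) (ha1 : a < 1) (R : Subring M)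
    (hRmem : ∀ b, b ∈ R ↔ ∀ q : ℕ, |b| ^ q * a < 1) (x : M) :
    (∀ r ∈ R, x * r ≠ 1) ↔ ∃ q : ℕ, |x| ^ (q + 1) ≤ a := by
  rw [forall_mul_ne_one_iff R x]
  constructor
  · rintro (rfl | hx)
    · exact ⟨0, by simpa using ha.le⟩
    · rw [hRmem] at hx
      push Not at hx
      obtain ⟨q, hq⟩ := hx
      cases q with
      | zero =>
        exfalso
        simp only [pow_zero, one_mul] at hq
        exact not_lt.2 hq ha1
      | succ q =>
        refine ⟨q, ?_⟩
        by_cases hx0 : x = 0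
        · subst hx0
          simpa using ha.le
        · rw [abs_inv, inv_pow] at hq
          have hxpos : 0 < |x| ^ (q + 1) := pow_pos (abs_pos.2 hx0) _
          rwa [inv_mul_eq_div, le_div_iff₀ hxpos, one_mul] at hq
  · rintro ⟨q, hq⟩
    by_cases hx0 : x = 0
    · exact Or.inl hx0
    · refine Or.inr fun hxR => ?_
      rw [hRmem] at hxR
      have h := hxR (q + 1)
      rw [abs_inv, inv_pow] at h
      have hxpos : 0 < |x| ^ (q + 1) := pow_pos (abs_pos.2 hx0) _
      rw [inv_mul_eq_div, div_lt_iff₀ hxpos, one_mul] at h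
      exact not_le.2 h hq

end Scale

/-! ### Bases and generators in a pregeometry of finite rank -/

section Pregeometry

open Literature.ModelTheory.Quasiminimal

/-- **Dimension bookkeeping** (den Besten 2016, Lemmas 7.1.9–7.1.13 as used in the proof of
Theorem 7.1.22: "`dim(k) = n - r` … take `c₁, …, c_r ∈ K` such that `{c₁, …, c_r}` forms a basis
for `K` over `k`").  In a pregeometry `cl`, a closed set `k` properly contained in the closure
`K` of `m` points is the closure of `m' < m` points, and `K ⊆ cl(k ∪ {C₁, …, C_r})` for some
`C₁, …, C_r ∈ K` with `m' + r ≤ m` (a basis of `k` extended to a basis of `K`; Mathlib's matroid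
of the pregeometry, `IsPregeometry.matroid`). [cite: DenBesten2016, Lemma 7.1.13] -/
theorem exists_generators_of_closed_subset {X : Type*} {cl : Set X → Set X}
    (h : IsPregeometry cl) {m : ℕ} (c : Fin m → X) {k : Set X} (hk : cl k = k)
    (hkK : k ⊆ cl (Set.range c)) (hne : k ≠ cl (Set.range c)) :
    ∃ (m' r : ℕ) (c' : Fin m' → X) (C : Fin r → X), m' < m ∧ m' + r ≤ m ∧
      cl (Set.range c') = k ∧ (∀ i, C i ∈ cl (Set.range c)) ∧
      cl (Set.range c) ⊆ cl (k ∪ Set.range C) := by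
  classical
  have hKcl : cl (cl (Set.range c)) = cl (Set.range c) := h.cl_cl _
  obtain ⟨Bk, hBk⟩ := h.matroid.exists_isBasis k (by simp [IsPregeometry.matroid_E])
  obtain ⟨B, hB, hBkB⟩ := hBk.indep.subset_isBasis_of_subset (hBk.subset.trans hkK)
    (by simp [IsPregeometry.matroid_E])
  have hclBk : cl Bk = k := by
    rw [← h.matroid_closure, hBk.closure_eq_closure, h.matroid_closure, hk]
  have hclB : cl B = cl (Set.range c) := by
    rw [← h.matroid_closure, hB.closure_eq_closure, h.matroid_closure, hKcl]
  -- cardinalities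
  have hrange : (Set.range c).encard ≤ m := by
    have h1 : (Set.range c).encard ≤ (univ : Set (Fin m)).encard := by
      rw [← image_univ]
      exact encard_image_le c univ
    simpa using h1
  have hBcard : B.encard ≤ m := by
    rw [hB.encard_eq_eRk]
    calc h.matroid.eRk (cl (Set.range c)) = h.matroid.eRk (h.matroid.closure (Set.range c)) := by
          rw [h.matroid_closure]
      _ = h.matroid.eRk (Set.range c) := Matroid.eRk_closure_eq _ _
      _ ≤ (Set.range c).encard := Matroid.eRk_le_encard _ _
      _ ≤ m := hrange
  have hBfin : B.Finite := finite_of_encard_le_coe hBcard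
  have hBkfin : Bk.Finite := hBfin.subset hBkB
  have hBkne : Bk ≠ B := by
    intro heq
    apply hne
    rw [← hclBk, heq, hclB]
  have hlt : Bk.encard < B.encard := hBkfin.encard_lt_encard (hBkB.ssubset_of_ne hBkne)
  obtain ⟨m', c', hc'⟩ := hBkfin.fin_embedding
  obtain ⟨r, C, hC⟩ := (hBfin.subset (fun z hz => hz.1 : B \ Bk ⊆ B)).fin_embedding
  have hm' : (Set.range c').encard = m' := by
    rw [← image_univ, c'.injective.encard_image]; simp
  have hr : (Set.range C).encard = r := by
    rw [← image_univ, C.injective.encard_image]; simp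
  have hsum : (B \ Bk).encard + Bk.encard = B.encard := encard_sdiff_add_encard_of_subset hBkB
  refine ⟨m', r, c', C, ?_, ?_, ?_, ?_, ?_⟩
  · have h1 : (m' : ℕ∞) < m := by
      rw [← hm', hc']
      exact hlt.trans_le hBcard
    exact_mod_cast h1
  · have h1 : (m' : ℕ∞) + r ≤ m := by
      rw [← hm', ← hr, hc', hC, add_comm, hsum]
      exact hBcard
    exact_mod_cast h1
  · rw [hc', hclBk]
  · intro i
    have hi : C i ∈ B \ Bk := hC ▸ Set.mem_range_self i
    rw [← hclB]
    exact h.subset_cl _ hi.1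
  · rw [← hclB]
    refine h.mono fun x hx => ?_
    by_cases hxk : x ∈ Bk
    · exact Or.inl (hBk.subset hxk)
    · exact Or.inr (hC ▸ ⟨hx, hxk⟩)

end Pregeometry

/-! ### In the models of `T_exp`: archimedean prime model, units, scales -/

section Model

open RealExpModel SaturationStep

variable (K : Language.Theory.ModelType.{0, 0, 0} realExpTheory)

/-- **`Dcl_e(∅)` is archimedean** (den Besten 2016, Remark 7.1.5: `Dcl(∅)` embeds in `ℝ`): an
element of `K` defined by a parameter-free `L_e`-formula is bounded by a natural number, because
the same formula defines a real number `r` and `∀ z (φ(z) → -n ≤ z ≤ n)`, `n ≥ |r|`, transfers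
from `ℝ` to `K`. [cite: DenBesten2016, Remark 7.1.5] -/
theorem exists_natCast_abs_le_of_mem_definableClosure_empty {x : K}
    (hx : x ∈ definableClosure Language.orderedERing (∅ : Set K)) : ∃ n : ℕ, |x| ≤ n := by
  classical
  have hx' : x ∈ definableClosure Language.orderedERing
      (Set.range (Fin.elim0 : Fin 0 → K)) := by
    rwa [Set.range_eq_empty]
  obtain ⟨φ, hφ⟩ := exists_formula_of_mem_definableClosure_range hx'
  -- the formula, over `Empty ⊕ Fin 1`
  let φ' : Language.orderedERing.Formula (Empty ⊕ Fin 1) :=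
    φ.relabel (Sum.map (Fin.elim0 : Fin 0 → Empty) id)
  have hφ' : ∀ (K' : Type) [Language.orderedERing.Structure K'] (e₀ : Empty → K')
      (i : Fin 1 → K'),
      φ'.Realize (Sum.elim e₀ i) ↔ φ.Realize (Sum.elim (Fin.elim0 : Fin 0 → K') i) := by
    intro K' _ e₀ i
    rw [Formula.realize_relabel]
    have hc : (Sum.elim e₀ i ∘ Sum.map (Fin.elim0 : Fin 0 → Empty) id) =
        Sum.elim (Fin.elim0 : Fin 0 → K') i := by
      funext a
      rcases a with a | a
      · exact a.elim0
      · rfl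
    rw [hc]
  -- `∃! z φ(z)` holds in `K`, hence in `ℝ`
  let σ₁ : Language.orderedERing.Sentence := Formula.iExsUnique (Fin 1) φ'
  have hσ₁ : ∀ (K' : Type) [Language.orderedERing.Structure K'],
      (K' ⊨ σ₁) ↔ ∃! i : Fin 1 → K', φ.Realize (Sum.elim (Fin.elim0 : Fin 0 → K') i) := by
    intro K' _
    show Formula.Realize σ₁ (default : Empty → K') ↔ _
    simp only [σ₁, Formula.realize_iExsUnique, hφ']
  have hK₁ : (K : Type) ⊨ σ₁ := by
    rw [hσ₁]
    refine ⟨fun _ => x, (hφ _).2 rfl, fun i hi => ?_⟩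
    funext j
    rw [Subsingleton.elim j 0]
    exact (hφ i).1 hi
  have hR₁ : ℝ ⊨ σ₁ := (realize_eSentence_iff_real K σ₁).1 hK₁
  obtain ⟨i₀, hi₀, hi₀u⟩ := (hσ₁ ℝ).1 hR₁
  -- a natural bound for the real solution
  obtain ⟨n, hn⟩ : ∃ n : ℕ, |i₀ 0| ≤ n := ⟨⌈|i₀ 0|⌉₊, Nat.le_ceil _⟩
  -- the bound as a formula `-n ≤ z ∧ z ≤ n`
  obtain ⟨nt, hnt⟩ := exists_term_natCast (α := Fin 1) n
  obtain ⟨θ₁, hθ₁⟩ := exists_formula_le (-nt) (Term.var 0)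
  obtain ⟨θ₂, hθ₂⟩ := exists_formula_le (Term.var 0) nt
  let θ : Language.orderedERing.Formula (Empty ⊕ Fin 1) :=
    ((LHom.sumInl : Language.orderedRing →ᴸ Language.orderedERing).onFormula (θ₁ ⊓ θ₂)).relabel
      Sum.inr
  have hθK : ∀ (e₀ : Empty → K) (i : Fin 1 → K), θ.Realize (Sum.elim e₀ i) ↔
      -(n : K) ≤ i 0 ∧ i 0 ≤ n := by
    intro e₀ i
    simp only [θ, Formula.realize_relabel, LHom.realize_onFormula, Sum.elim_comp_inr,
      Formula.realize_inf, hθ₁, hθ₂, Language.orderedRing.realize_neg, hnt, Term.realize_var]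
  have hθR : ∀ (e₀ : Empty → ℝ) (i : Fin 1 → ℝ), θ.Realize (Sum.elim e₀ i) ↔
      -(n : ℝ) ≤ i 0 ∧ i 0 ≤ n := by
    intro e₀ i
    simp only [θ, Formula.realize_relabel, LHom.realize_onFormula, Sum.elim_comp_inr,
      Formula.realize_inf, hθ₁, hθ₂, Language.orderedRing.realize_neg, hnt, Term.realize_var]
  let σ₂ : Language.orderedERing.Sentence := Formula.iAlls (Fin 1) (Formula.imp φ' θ)
  have hσ₂ : ∀ (K' : Type) [Language.orderedERing.Structure K'],
      (K' ⊨ σ₂) ↔ ∀ i : Fin 1 → K', φ'.Realize (Sum.elim (default : Empty → K') i) →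
        θ.Realize (Sum.elim (default : Empty → K') i) := by
    intro K' _
    show Formula.Realize σ₂ (default : Empty → K') ↔ _
    simp only [σ₂, Formula.realize_iAlls, Formula.realize_imp]
  have hR₂ : ℝ ⊨ σ₂ := by
    rw [hσ₂]
    intro i hi
    rw [hφ'] at hi
    have heq : i = i₀ := hi₀u i hi
    rw [hθR, heq]
    exact abs_le.1 hn
  have hK₂ : (K : Type) ⊨ σ₂ := (realize_eSentence_iff_real K σ₂).2 hR₂
  rw [hσ₂] at hK₂
  refine ⟨n, abs_le.2 ?_⟩
  have h := hK₂ (fun _ => x) ((hφ' K _ _).2 ((hφ _).2 rfl))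
  rw [hθK] at h
  exact h

/-- Hence **the non-zero elements of `Dcl_e(∅)` are valuation units**. [cite: DenBesten2016, Remark 7.1.5] -/
theorem isVUnit_of_mem_definableClosure_empty {x : K}
    (hx : x ∈ definableClosure Language.orderedERing (∅ : Set K)) (hx0 : x ≠ 0) : IsVUnit x := by
  obtain ⟨n, hn⟩ := exists_natCast_abs_le_of_mem_definableClosure_empty K hx
  obtain ⟨n', hn'⟩ := exists_natCast_abs_le_of_mem_definableClosure_empty K
    (OrderedFieldExpansion.inv_mem_definableClosure
      (LHom.sumInl : Language.orderedRing →ᴸ Language.orderedERing) hx)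
  refine ⟨n + n', ?_, ?_⟩
  · have hxpos : 0 < |x| := abs_pos.2 hx0
    rw [abs_inv] at hn'
    have h1 : 1 ≤ (n' : K) * |x| := by
      have := mul_le_mul_of_nonneg_right hn' hxpos.le
      rwa [inv_mul_cancel₀ hxpos.ne'] at this
    calc (1 : K) ≤ n' * |x| := h1
      _ ≤ (n + n' : ℕ) * |x| := by gcongr; exact_mod_cast Nat.le_add_left n' n
  · calc |x| ≤ n := hn
      _ ≤ (n + n' : ℕ) := by exact_mod_cast Nat.le_add_right n n'

variable {K}

/-- A non-zero non-unit is infinitesimal or infinite. [folklore] -/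
theorem forall_lt_or_forall_lt_of_not_isVUnit {y : K} (hy : ¬ IsVUnit y) (hy0 : y ≠ 0) :
    (∀ n : ℕ, (n : K) * |y| < 1) ∨ (∀ n : ℕ, (n : K) < |y|) := by
  by_cases h : ∃ n : ℕ, 1 ≤ (n : K) * |y|
  · right
    obtain ⟨n, hn⟩ := h
    intro N
    by_contra hN
    push Not at hN
    apply hy
    refine ⟨n + N, ?_, ?_⟩
    · calc (1 : K) ≤ n * |y| := hn
        _ ≤ (n + N : ℕ) * |y| := by gcongr; exact_mod_cast Nat.le_add_right n N
    · calc |y| ≤ N := hN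
        _ ≤ (n + N : ℕ) := by exact_mod_cast Nat.le_add_left N n
  · left
    push Not at h
    exact h

/-- An element of `I_a` (`|η|^{q+1} ≤ a`, `a` infinitesimal) is infinitesimal. [folklore] -/
theorem natCast_mul_abs_lt_one_of_pow_le {a η : K} (hainf : ∀ n : ℕ, (n : K) * a < 1)
    {q : ℕ} (hη : |η| ^ (q + 1) ≤ a) (n : ℕ) : (n : K) * |η| < 1 := by
  by_contra hcon
  push Not at hcon
  -- `1 ≤ (n |η|)^{q+1} ≤ n^{q+1} a < 1`
  have h1 : (1 : K) ≤ ((n : K) * |η|) ^ (q + 1) := one_le_pow₀ hcon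
  have h2 : ((n : K) * |η|) ^ (q + 1) ≤ (n : K) ^ (q + 1) * a := by
    rw [mul_pow]
    gcongr
  have h3 : (n : K) ^ (q + 1) * a < 1 := by
    have := hainf (n ^ (q + 1))
    push_cast at this
    exact this
  linarith

/-- `1 + η` is a valuation unit for `η` infinitesimal. [folklore] -/
theorem isVUnit_one_add {η : K} (hη : ∀ n : ℕ, (n : K) * |η| < 1) : IsVUnit (1 + η) := by
  have h2 : (2 : K) * |η| < 1 := by exact_mod_cast hη 2
  have h3 : |(1 : K)| - |η| ≤ |1 + η| := by
    have := abs_sub_abs_le_abs_sub (1 : K) (-η)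
    rwa [abs_neg, sub_neg_eq_add] at this
  rw [abs_one] at h3
  have h4 : |1 + η| ≤ |(1 : K)| + |η| := abs_add_le 1 η
  rw [abs_one] at h4
  refine ⟨2, ?_, ?_⟩
  · push_cast
    linarith
  · push_cast
    linarith

/-! ### Claim 2 in the form used here -/

/-- **Claim 2 of den Besten's Theorem 7.1.22 for elements algebraic over `k[C₁, …, C_r]`**
(`RealExpModel.exists_isVUnit_of_isAlgebraic_adjoin` of `Wilkie1996ValuationAlgebraic.lean`,
rephrased for a subfield `k ⊆ M`, a tuple `C ∈ Mʳ` and `r + 1` non-zero elements each of which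
is a root of a non-zero polynomial with coefficients in the ring `k[C]`): they satisfy
`b · Π yⱼ^{eⱼ} ∈ Fin(M)^×` for some `e ≠ 0` and `b ∈ k^×` ("`dim_ℚ ν[k*^×] ≤ valdim(k) + r`").
[cite: DenBesten2016, Theorem 7.1.22, Claim 2] -/
theorem exists_isVUnit_rel_of_algebraic (kF : Subfield K) {r : ℕ} (C : Fin r → K)
    (y : Fin (r + 1) → K) (hy0 : ∀ j, y j ≠ 0)
    (halg : ∀ j, ∃ p : Polynomial K, p ≠ 0 ∧
      (∀ n, p.coeff n ∈ Subring.closure ((kF : Set K) ∪ Set.range C)) ∧ p.eval (y j) = 0) :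
    ∃ e : Fin (r + 1) → ℤ, e ≠ 0 ∧ ∃ b ∈ kF, b ≠ 0 ∧ IsVUnit (b * ∏ j, y j ^ e j) := by
  classical
  let S : Subalgebra kF K := Algebra.adjoin kF (Set.range C ∪ Set.range y)
  have hCS : ∀ i, C i ∈ S := fun i => Algebra.subset_adjoin (Or.inl ⟨i, rfl⟩)
  have hyS : ∀ j, y j ∈ S := fun j => Algebra.subset_adjoin (Or.inr ⟨j, rfl⟩)
  let c : Fin r → S := fun i => ⟨C i, hCS i⟩
  let yS : Fin (r + 1) → S := fun j => ⟨y j, hyS j⟩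
  let R₀ : Subalgebra kF S := Algebra.adjoin kF (Set.range c)
  -- the ring homomorphism `R₀ → K` and its range
  let f : R₀ →+* K := (algebraMap S K : S →+* K).comp (algebraMap R₀ S : R₀ →+* S)
  have hf : ∀ w : R₀, f w = ((w : S) : K) := fun w => rfl
  have hrange : ∀ z ∈ Subring.closure ((kF : Set K) ∪ Set.range C), z ∈ Set.range f := by
    intro z hz
    induction hz using Subring.closure_induction with
    | mem z hz =>
      rcases hz with hz | ⟨i, rfl⟩
      · exact ⟨algebraMap kF R₀ ⟨z, hz⟩, rfl⟩
      · exact ⟨⟨c i, Algebra.subset_adjoin ⟨i, rfl⟩⟩, rfl⟩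
    | zero => exact ⟨0, map_zero f⟩
    | one => exact ⟨1, map_one f⟩
    | add u w _ _ hu hw =>
      obtain ⟨u', rfl⟩ := hu
      obtain ⟨w', rfl⟩ := hw
      exact ⟨u' + w', map_add f u' w'⟩
    | neg u _ hu =>
      obtain ⟨u', rfl⟩ := hu
      exact ⟨-u', map_neg f u'⟩
    | mul u w _ _ hu hw =>
      obtain ⟨u', rfl⟩ := hu
      obtain ⟨w', rfl⟩ := hw
      exact ⟨u' * w', map_mul f u' w'⟩
  -- `S` is algebraic over `R₀ = k[c̄]`
  haveI halgS : Algebra.IsAlgebraic R₀ S := by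
    refine ⟨fun s => ?_⟩
    obtain ⟨s, hs⟩ := s
    induction hs using Algebra.adjoin_induction with
    | mem z hz =>
      rcases hz with ⟨i, rfl⟩ | ⟨j, rfl⟩
      · have h : (⟨C i, hCS i⟩ : S) = algebraMap R₀ S ⟨c i, Algebra.subset_adjoin ⟨i, rfl⟩⟩ := rfl
        rw [show (⟨C i, Algebra.subset_adjoin (Or.inl ⟨i, rfl⟩)⟩ : S) = ⟨C i, hCS i⟩ from rfl, h]
        exact isAlgebraic_algebraMap _
      · obtain ⟨p, hp0, hpc, hpy⟩ := halg j
        have hlift : p ∈ Polynomial.lifts f := by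
          rw [Polynomial.lifts_iff_coeff_lifts]
          intro n
          exact hrange _ (hpc n)
        obtain ⟨q, hq⟩ := (Polynomial.mem_lifts p).1 hlift
        have hq0 : q ≠ 0 := by
          rintro rfl
          rw [Polynomial.map_zero] at hq
          exact hp0 hq.symm
        refine ⟨q, hq0, ?_⟩
        have h0 : (algebraMap S K) (Polynomial.aeval (⟨y j, hyS j⟩ : S) q) = 0 := by
          rw [Polynomial.aeval_def,
            Polynomial.hom_eval₂ q (algebraMap R₀ S) (algebraMap S K : S →+* K)]
          show Polynomial.eval₂ f (y j) q = 0
          rw [← Polynomial.eval_map, hq]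
          exact hpy
        have hinj : Function.Injective (algebraMap S K) := Subtype.val_injective
        exact (injective_iff_map_eq_zero (algebraMap S K)).1 hinj _ h0
    | algebraMap b =>
      have h : (⟨algebraMap kF K b, Subalgebra.algebraMap_mem S b⟩ : S) =
          algebraMap R₀ S (algebraMap kF R₀ b) := Subtype.ext rfl
      convert isAlgebraic_algebraMap (R := R₀) (A := S) (algebraMap kF R₀ b) using 1
    | add u w hu hw ihu ihw => exact ihu.add ihw
    | mul u w hu hw ihu ihw => exact ihu.mul ihw
  have hy0' : ∀ j, (yS j : K) ≠ 0 := fun j => hy0 j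
  obtain ⟨e, he, b, hb0, hu⟩ := exists_isVUnit_of_isAlgebraic_adjoin S c yS hy0'
  refine ⟨e, he, (b : K), b.2, fun h => hb0 (Subtype.ext h), ?_⟩
  exact hu

end Model

/-! ### Theorem 7.1.22 assembled -/

section Main

open RealExpModel SaturationStep Literature.ModelTheory.Quasiminimal

/-- **den Besten 2016, Theorem 7.1.22 for `T_e` (`valdim(K) ≤ dim(K)` for the finitely
generated `L_e`-definable closures `K = Dcl_e(c₁, …, c_m)` in a model `M` of `T_exp`),
assembled from its printed ingredients**: the First Main Theorem for `exp↾[0,1]`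
(`hMC`, giving the o-minimality of `M | L_e`), condition `S₁` of Theorem 7.2.1 (`hS1`:
polynomial bounds in every `M | L_e`), and the **surjectivity step** of the printed proof
(`hsurj`, pp. 86–89: with `k ≼ K` splitting the convex ring `R` attached to the smallest scale
`a` of `K`, `c₁, …, c_r ∈ I` and `K ⊆ Dcl(k ∪ {c̄})`, every non-zero `d ∈ I ∩ K` has the value of
an element algebraic over `k[c̄]` — the part of the proof that uses smoothness `S₂`, Taylor
expansion and the extreme value theorem).  Conclusion (`habs` of
`Wilkie1996SaturationStep.lean`): any `m + 1` non-zero elements of `Dcl_e(c₁, …, c_m)` have a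
non-trivial power product in `Fin(M)^×`.

Proof as printed (pp. 82–87), by induction on `m` inside the fixed model `M`: if every non-zero
element of `K` is a unit there is nothing to do (the case "`K` Archimedean"); otherwise Claim 1
(`OMinimalPolynomiallyBounded.lean`) gives the smallest scale `a ∈ K`, infinitesimal; `R`, `I`
as printed; Theorem 7.1.21 inside `K` (`exists_elementarySubstructure_splits_subset`) gives
`k`; `k ≠ K` as `a⁻¹ ∉ R`; a basis of `k` extended to one of `K`
(`exists_generators_of_closed_subset`) gives `dim(k) = m' < m` generators of `k` and `r`
further generators, moved into `I`; the induction hypothesis bounds the valuative rank of `k`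
by `m'`, Claim 2 (`exists_isVUnit_rel_of_algebraic`) that of `k* ⊇ k(c̄)` over `k` by `r`, and
`hsurj` (with the splitting, for the elements outside `I`) shows that every value of `K` is a
value of `k*`; the tower lemma of `Wilkie1996ValRankTower.lean` concludes.
[cite: DenBesten2016, Theorem 7.1.22 (pp. 82–87)] [cite: WilkieJAMS1996, §10] -/
theorem absolute_of_surjectivity (hMC : rexpTheory.IsModelComplete)
    (hS1 : ∀ K : Language.Theory.ModelType.{0, 0, 0} realExpTheory,
      IsPolynomiallyBounded Language.orderedERing K)
    (hsurj : ∀ (M : Language.Theory.ModelType.{0, 0, 0} realExpTheory) (K k : Set M),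
      definableClosure Language.orderedERing K = K →
      definableClosure Language.orderedERing k = k → k ⊆ K →
      ∀ (a : M), a ∈ K → 0 < a → (∀ n : ℕ, (n : M) * a < 1) →
      (∀ b ∈ K, 0 < b → ∃ q : ℕ, a ^ q < b) →
      (∀ b ∈ k, ∀ q : ℕ, |b| ^ q * a < 1) →
      (∀ b ∈ K, (∀ q : ℕ, |b| ^ q * a < 1) → ∃ b' ∈ k, b < b') →
      (∀ b ∈ K, (∀ q : ℕ, |b| ^ q * a < 1) → ∃ b₀ ∈ k, ∃ q : ℕ, |b - b₀| ^ (q + 1) ≤ a) →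
      ∀ (r : ℕ) (C : Fin r → M), (∀ i, C i ∈ K) → (∀ i, ∃ q : ℕ, |C i| ^ (q + 1) ≤ a) →
      K ⊆ definableClosure Language.orderedERing (k ∪ Set.range C) →
      ∀ d ∈ K, d ≠ 0 → (∃ q : ℕ, |d| ^ (q + 1) ≤ a) →
      ∃ α : M, (∃ p : Polynomial M, p ≠ 0 ∧
        (∀ n, p.coeff n ∈ Subring.closure (k ∪ Set.range C)) ∧ p.eval α = 0) ∧
        IsVUnit (α / d))
    (M : Language.Theory.ModelType.{0, 0, 0} realExpTheory) (m : ℕ) (c : Fin m → M)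
    (x : Fin (m + 1) → M) (hx : ∀ j, x j ∈ definableClosure Language.orderedERing (Set.range c))
    (hx0 : ∀ j, x j ≠ 0) : ∃ e : Fin (m + 1) → ℤ, e ≠ 0 ∧ IsVUnit (∏ j, x j ^ e j) := by
  classical
  induction m using Nat.strong_induction_on with
  | _ m IH => ?_
  set φe : Language.orderedRing →ᴸ Language.orderedERing := LHom.sumInl with hφe
  have hO : Language.orderedERing.IsOMinimal M :=
    isOMinimal_orderedERing_of_rexp_isModelComplete hMC M
  have hP : IsPregeometry (fun A : Set M => definableClosure Language.orderedERing A) :=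
    isPregeometry_definableClosure_of_orderedStructure hO
  set K : Set M := definableClosure Language.orderedERing (Set.range c) with hKdef
  have hKcl : definableClosure Language.orderedERing K = K := definableClosure_definableClosure _
  -- `K` is a subfield
  have hKof : ∀ {z : M}, z ∈ definableClosure Language.orderedERing K → z ∈ K := fun hz => by
    rwa [hKcl] at hz
  have hKneg : ∀ z ∈ K, -z ∈ K := fun z hz =>
    hKof (OrderedFieldExpansion.neg_mem_definableClosure φe (subset_definableClosure K hz))
  have hKsub : ∀ z ∈ K, ∀ w ∈ K, z - w ∈ K := fun z hz w hw =>
    hKof (OrderedFieldExpansion.sub_mem_definableClosure φe (subset_definableClosure K hz)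
      (subset_definableClosure K hw))
  have hKinv : ∀ z ∈ K, z⁻¹ ∈ K := fun z hz =>
    hKof (OrderedFieldExpansion.inv_mem_definableClosure φe (subset_definableClosure K hz))
  have hKabs : ∀ z ∈ K, |z| ∈ K := fun z hz => by
    rcases abs_choice z with h | h
    · rw [h]; exact hz
    · rw [h]; exact hKneg z hz
  -- the archimedean case
  by_cases hunit : ∀ y ∈ K, y ≠ 0 → IsVUnit y
  · refine ⟨Pi.single 0 1, ?_, ?_⟩
    · intro h
      have := congrFun h 0
      simp at this
    · have hprod : ∏ j, x j ^ (Pi.single (0 : Fin (m + 1)) (1 : ℤ) : Fin (m + 1) → ℤ) j = x 0 := by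
        rw [Finset.prod_eq_single (0 : Fin (m + 1))]
        · simp
        · intro j _ hj
          simp [Pi.single_eq_of_ne hj]
        · simp
      rw [hprod]
      exact hunit _ (hx 0) (hx0 0)
  push Not at hunit
  obtain ⟨y, hyK, hy0, hyu⟩ := hunit
  -- Claim 1: the smallest scale `a` of `K`
  have harch : ∀ z ∈ definableClosure Language.orderedERing (∅ : Set M), ∃ n : ℕ, |z| ≤ n :=
    fun z hz => exists_natCast_abs_le_of_mem_definableClosure_empty M hz
  obtain ⟨a, haK, ha0, ha1, hcoi⟩ :=
    exists_pow_lt_definableClosure_finset φe hO (hS1 M) harch (Finset.univ.image c)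
  have hcoe : (↑(Finset.univ.image c) : Set M) = Set.range c := by
    ext z
    simp
  rw [hcoe] at haK hcoi
  -- `a` is infinitesimal (`K` has a non-unit)
  have hainf : ∀ n : ℕ, (n : M) * a < 1 := by
    -- a positive infinitesimal in `K`
    have hε : ∃ ε ∈ K, 0 < ε ∧ ∀ n : ℕ, (n : M) * ε < 1 := by
      rcases forall_lt_or_forall_lt_of_not_isVUnit hyu hy0 with h | h
      · exact ⟨|y|, hKabs y hyK, abs_pos.2 hy0, h⟩
      · refine ⟨|y|⁻¹, hKinv _ (hKabs y hyK), inv_pos.2 (abs_pos.2 hy0), fun n => ?_⟩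
        rw [← div_eq_mul_inv, div_lt_one (abs_pos.2 hy0)]
        exact h n
    obtain ⟨ε, hεK, hε0, hεinf⟩ := hε
    obtain ⟨q, hq⟩ := hcoi ε hεK hε0
    intro n
    by_contra hcon
    push Not at hcon
    have h1 : (1 : M) ≤ ((n : M) * a) ^ q := one_le_pow₀ hcon
    have h2 : ((n : M) * a) ^ q ≤ (n : M) ^ q * ε := by
      rw [mul_pow]
      gcongr
    have h3 : (n : M) ^ q * ε < 1 := by
      have := hεinf (n ^ q)
      push_cast at this
      exact this
    linarith
  -- the convex subring `R` and the splitting elementary substructure `k ⊆ K`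
  obtain ⟨R, hRmem, hRconv⟩ := exists_subring_scale ha0 hainf
  let S₀ : Language.orderedERing.ElementarySubstructure M :=
    ⟨definableClosureSubstructure Language.orderedERing (∅ : Set M),
      isElementary_definableClosureSubstructure_of_orderedField φe hO ∅⟩
  have hS₀coe : (S₀ : Set M) = definableClosure Language.orderedERing (∅ : Set M) := rfl
  have hS₀R : (S₀ : Set M) ⊆ R := by
    rw [hS₀coe]
    exact definableClosure_empty_subset_of_forall_abs_le R hRconv harch
  have hS₀K : (S₀ : Set M) ⊆ K := by
    rw [hS₀coe]
    exact definableClosure_mono (Set.empty_subset _)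
  obtain ⟨T, -, hTR, hTK, hcof, hsplit⟩ :=
    exists_elementarySubstructure_splits_subset φe hO (hS1 M) K hKcl R hRconv S₀ hS₀R hS₀K
  set k : Set M := (T : Set M) with hkdef
  have hkcl : definableClosure Language.orderedERing k = k :=
    definableClosure_eq_of_meetsDefinable T.meetsDefinable
  have hkof : ∀ {z : M}, z ∈ definableClosure Language.orderedERing k → z ∈ k := fun hz => by
    rwa [hkcl] at hz
  have hkK : k ⊆ K := hTK
  have hkR : ∀ b ∈ k, ∀ q : ℕ, |b| ^ q * a < 1 := fun b hb => (hRmem b).1 (hTR hb)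
  have hsplit' : ∀ b ∈ K, (∀ q : ℕ, |b| ^ q * a < 1) →
      ∃ b₀ ∈ k, ∃ q : ℕ, |b - b₀| ^ (q + 1) ≤ a := by
    intro b hbK hbR
    obtain ⟨b₀, hb₀T, hb₀⟩ := hsplit b ((hRmem b).2 hbR) hbK
    exact ⟨b₀, hb₀T, (forall_mul_ne_one_iff_scale ha0 ha1 R hRmem _).1 hb₀⟩
  have hcof' : ∀ b ∈ K, (∀ q : ℕ, |b| ^ q * a < 1) → ∃ b' ∈ k, b < b' :=
    fun b hbK hbR => hcof b ((hRmem b).2 hbR) hbK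
  -- `k ≠ K`: `a⁻¹ ∈ K ∖ R`
  have haKinv : a⁻¹ ∈ K := hKinv a haK
  have hainvR : ¬ ∀ q : ℕ, |a⁻¹| ^ q * a < 1 := by
    intro h
    have := h 1
    rw [pow_one, abs_inv, abs_of_pos ha0, inv_mul_cancel₀ ha0.ne'] at this
    exact lt_irrefl _ this
  have hkne : k ≠ K := fun heq => hainvR (hkR _ (heq.symm ▸ haKinv))
  -- generators: `k = Dcl(c')`, `|c'| = m' < m`, and `C` with `K ⊆ Dcl(k ∪ C)`, `m' + r ≤ m`
  obtain ⟨m', r, c', C, hm'm, hsum, hclc', hCK, hKgen⟩ :=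
    exists_generators_of_closed_subset hP c hkcl hkK hkne
  -- move the generators `C` into `I`
  have hCfix : ∀ i, ∃ C' : M, C' ∈ K ∧ (∃ q : ℕ, |C'| ^ (q + 1) ≤ a) ∧
      C i ∈ definableClosure Language.orderedERing (insert C' k) := by
    intro i
    by_cases hCR : ∀ q : ℕ, |C i| ^ q * a < 1
    · obtain ⟨b₀, hb₀k, q, hq⟩ := hsplit' (C i) (hCK i) hCR
      refine ⟨C i - b₀, hKsub _ (hCK i) _ (hkK hb₀k), ⟨q, hq⟩, ?_⟩
      have h := OrderedFieldExpansion.add_mem_definableClosure φe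
        (subset_definableClosure (insert (C i - b₀) k) (Set.mem_insert _ _))
        (subset_definableClosure (insert (C i - b₀) k) (Set.mem_insert_of_mem _ hb₀k))
      rwa [sub_add_cancel] at h
    · push Not at hCR
      obtain ⟨q, hq⟩ := hCR
      have hC0 : C i ≠ 0 := by
        intro h0
        rw [h0, abs_zero] at hq
        cases q with
        | zero =>
          rw [pow_zero, one_mul] at hq
          exact not_lt.2 hq ha1
        | succ q =>
          rw [zero_pow (Nat.succ_ne_zero q), zero_mul] at hq
          exact not_lt.2 hq one_pos
      refine ⟨(C i)⁻¹, hKinv _ (hCK i), ?_, ?_⟩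
      · cases q with
        | zero =>
          exfalso
          simp at hq
          exact not_lt.2 hq ha1
        | succ q =>
          refine ⟨q, ?_⟩
          rw [abs_inv, inv_pow]
          have hpos : 0 < |C i| ^ (q + 1) := pow_pos (abs_pos.2 hC0) _
          rw [inv_le_iff_one_le_mul₀' hpos]
          exact hq
      · have h := OrderedFieldExpansion.inv_mem_definableClosure φe
          (subset_definableClosure (insert (C i)⁻¹ k) (Set.mem_insert _ _))
        rwa [inv_inv] at h
  choose C' hC'K hC'I hC'gen using hCfix
  have hKgen' : K ⊆ definableClosure Language.orderedERing (k ∪ Set.range C') := by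
    refine hKgen.trans (definableClosure_subset_of_subset ?_)
    rintro z (hz | ⟨i, rfl⟩)
    · exact subset_definableClosure _ (Or.inl hz)
    · exact definableClosure_mono
        (Set.insert_subset (Set.mem_union_right _ (Set.mem_range_self i))
          Set.subset_union_left) (hC'gen i)
  -- the subfield `k`
  let kF : Subfield M :=
    { carrier := k
      mul_mem' := fun {u w} hu hw => hkof (DclClaim.mul_mem_definableClosure φe
        (subset_definableClosure k hu) (subset_definableClosure k hw))
      one_mem' := hkof (DclClaim.one_mem_definableClosure φe)
      add_mem' := fun {u w} hu hw => hkof (OrderedFieldExpansion.add_mem_definableClosure φe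
        (subset_definableClosure k hu) (subset_definableClosure k hw))
      zero_mem' := hkof (definableClosure_mono (Set.empty_subset _)
        (zero_mem_definableClosure φe))
      neg_mem' := fun {u} hu => hkof (OrderedFieldExpansion.neg_mem_definableClosure φe
        (subset_definableClosure k hu))
      inv_mem' := fun u hu => hkof (OrderedFieldExpansion.inv_mem_definableClosure φe
        (subset_definableClosure k hu)) }
  have hkF : (kF : Set M) = k := rfl
  -- the induction hypothesis for `k = Dcl(c')`
  have hIHk : ∀ z : Fin (m' + 1) → M, (∀ l, z l ∈ k) → (∀ l, z l ≠ 0) →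
      ∃ d : Fin (m' + 1) → ℤ, d ≠ 0 ∧ IsVUnit (∏ l, z l ^ d l) := by
    intro z hz hz0
    refine IH m' hm'm c' z (fun l => ?_) hz0
    have h : z l ∈ k := hz l
    rw [← hclc'] at h
    exact h
  -- `I · R ⊆ I`
  have hIR : ∀ η ρ : M, (∃ q : ℕ, |η| ^ (q + 1) ≤ a) → (∀ q : ℕ, |ρ| ^ q * a < 1) →
      ∃ q : ℕ, |η * ρ| ^ (q + 1) ≤ a := by
    rintro η ρ ⟨q, hq⟩ hρ
    refine ⟨2 * q + 1, ?_⟩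
    have h : |η * ρ| ^ (2 * q + 1 + 1) = (|η| ^ (q + 1)) ^ 2 * |ρ| ^ (2 * q + 2) := by
      rw [abs_mul, mul_pow, ← pow_mul]
      ring_nf
    rw [h]
    have h1 : (|η| ^ (q + 1)) ^ 2 ≤ a ^ 2 := by gcongr
    have h2 : |ρ| ^ (2 * q + 2) * a < 1 := hρ _
    have h3 : 0 ≤ |ρ| ^ (2 * q + 2) := pow_nonneg (abs_nonneg _) _
    calc (|η| ^ (q + 1)) ^ 2 * |ρ| ^ (2 * q + 2) ≤ a ^ 2 * |ρ| ^ (2 * q + 2) := by gcongr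
      _ = a * (|ρ| ^ (2 * q + 2) * a) := by ring
      _ ≤ a * 1 := by gcongr
      _ = a := mul_one a
  -- algebraic approximants: `x_j^{s_j} = β_j · (unit)`, `β_j ∈ k*`, `s_j = ± 1`
  have hβ : ∀ j, ∃ (β : M) (s : ℤ), (s = 1 ∨ s = -1) ∧ β ≠ 0 ∧
      (∃ p : Polynomial M, p ≠ 0 ∧
        (∀ n, p.coeff n ∈ Subring.closure (k ∪ Set.range C')) ∧ p.eval β = 0) ∧
      IsVUnit (x j ^ s / β) := by
    intro j
    have hxK : x j ∈ K := hx j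
    by_cases hxI : ∃ q : ℕ, |x j| ^ (q + 1) ≤ a
    · obtain ⟨α, halg, hu⟩ := hsurj M K k hKcl hkcl hkK a haK ha0 hainf hcoi hkR hcof' hsplit'
        r C' hC'K hC'I hKgen' (x j) hxK (hx0 j) hxI
      have hα0 : α ≠ 0 := by
        intro h0
        rw [h0, zero_div] at hu
        exact hu.ne_zero rfl
      refine ⟨α, 1, Or.inl rfl, hα0, halg, ?_⟩
      rw [zpow_one]
      have h := hu.inv
      rwa [inv_div] at h
    · by_cases hxR : ∀ q : ℕ, |x j| ^ q * a < 1
      · -- a unit of `R`: split by an element of `k`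
        obtain ⟨b₀, hb₀k, q, hq⟩ := hsplit' (x j) hxK hxR
        have hb₀0 : b₀ ≠ 0 := by
          rintro rfl
          exact hxI ⟨q, by simpa using hq⟩
        refine ⟨b₀, 1, Or.inl rfl, hb₀0, ⟨Polynomial.X - Polynomial.C b₀,
          Polynomial.X_sub_C_ne_zero b₀, fun n => ?_, by simp⟩, ?_⟩
        · rw [Polynomial.coeff_sub, Polynomial.coeff_X, Polynomial.coeff_C]
          refine Subring.sub_mem _ ?_ ?_
          · split_ifs
            · exact Subring.one_mem _
            · exact Subring.zero_mem _
          · split_ifs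
            · exact Subring.subset_closure (Or.inl hb₀k)
            · exact Subring.zero_mem _
        · -- `x / b₀ = 1 + (x - b₀) b₀⁻¹`, with `(x - b₀) b₀⁻¹ ∈ I` infinitesimal
          have heq : x j ^ (1 : ℤ) / b₀ = 1 + (x j - b₀) * b₀⁻¹ := by
            rw [zpow_one]
            field_simp
            ring
          rw [heq]
          obtain ⟨q', hq'⟩ := hIR (x j - b₀) b₀⁻¹ ⟨q, hq⟩ (hkR _ (kF.inv_mem hb₀k))
          exact isVUnit_one_add (natCast_mul_abs_lt_one_of_pow_le hainf hq')
      · -- outside `R`: the inverse lies in `I`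
        push Not at hxR
        obtain ⟨q, hq⟩ := hxR
        obtain ⟨q', rfl⟩ : ∃ q', q = q' + 1 := by
          cases q with
          | zero =>
            exfalso
            simp at hq
            exact not_lt.2 hq ha1
          | succ q => exact ⟨q, rfl⟩
        have hinvI : ∃ q : ℕ, |(x j)⁻¹| ^ (q + 1) ≤ a := by
          refine ⟨q', ?_⟩
          rw [abs_inv, inv_pow]
          have hpos : 0 < |x j| ^ (q' + 1) := pow_pos (abs_pos.2 (hx0 j)) _
          rw [inv_le_iff_one_le_mul₀' hpos]
          exact hq
        obtain ⟨α, halg, hu⟩ := hsurj M K k hKcl hkcl hkK a haK ha0 hainf hcoi hkR hcof' hsplit'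
          r C' hC'K hC'I hKgen' (x j)⁻¹ (hKinv _ hxK) (inv_ne_zero (hx0 j)) hinvI
        have hα0 : α ≠ 0 := by
          intro h0
          rw [h0, zero_div] at hu
          exact hu.ne_zero rfl
        refine ⟨α, -1, Or.inr rfl, hα0, halg, ?_⟩
        rw [zpow_neg_one]
        have h := hu.inv
        rwa [inv_div] at h
  choose β sgn hsgn hβ0 hβalg hβu using hβ
  -- relations among the first `m' + r + 1` of the `β`'s, by the tower lemma
  have hle : m' + r + 1 ≤ m + 1 := by omega
  have hι : Function.Injective (Fin.castLE hle) := Fin.castLE_injective hle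
  obtain ⟨E, hE, hEu⟩ := ValRankTower.exists_zpow_rel_of_tower (K := M)
    (H := fun u => IsVUnit u) (A := fun z => z ∈ k)
    isVUnit_one (fun hu hv => hu.mul hv) (fun hu => hu.inv) (r₁ := m') (r₂ := r)
    (fun z hz hz0 => hIHk z hz hz0)
    (fun l => β (Fin.castLE hle l)) (fun l => hβ0 _)
    (fun σ _ => by
      obtain ⟨e, he, b, hbk, hb0, hu⟩ := exists_isVUnit_rel_of_algebraic kF C'
        (fun l => β (Fin.castLE hle (σ l))) (fun l => hβ0 _) (fun l => hβalg _)
      exact ⟨e, he, b, hbk, hb0, hu⟩)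
  -- back to the `x`'s: `x_j^{s_j E_j} = β_j^{E_j} · unit`
  refine ⟨Function.extend (Fin.castLE hle) (fun l => sgn (Fin.castLE hle l) * E l) 0,
    ValRankTower.extend_ne_zero hι ?_, ?_⟩
  · intro h0
    apply hE
    funext l
    have h := congrFun h0 l
    simp only [Pi.zero_apply, mul_eq_zero] at h
    rcases h with h | h
    · rcases hsgn (Fin.castLE hle l) with hs | hs <;> rw [hs] at h <;> norm_num at h
    · exact h
  · rw [ValRankTower.prod_zpow_extend hι]
    have hfac : ∀ l, x (Fin.castLE hle l) ^ (sgn (Fin.castLE hle l) * E l) =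
        β (Fin.castLE hle l) ^ E l *
          (x (Fin.castLE hle l) ^ sgn (Fin.castLE hle l) / β (Fin.castLE hle l)) ^ E l := by
      intro l
      rw [zpow_mul, ← mul_zpow, mul_div_cancel₀ _ (hβ0 _)]
    rw [Finset.prod_congr rfl fun l _ => hfac l, Finset.prod_mul_distrib]
    exact hEu.mul (ValRankTower.pred_prod isVUnit_one (fun hu hv => hu.mul hv) _
      fun l _ => ValRankTower.pred_zpow isVUnit_one (fun hu hv => hu.mul hv) (fun hu => hu.inv)
        (hβu _) _)

end Main

end AbsoluteInequality

/-! ### The leaf and Wilkie's theorem from `hMC`, `S₁` and the surjectivity step -/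

/-- **The boundedness leaf from the First Main Theorem, polynomial bounds `S₁` for `T_e` and
the surjectivity step of den Besten's Theorem 7.1.22** (through `habs`,
`Wilkie1996SaturationStep.lean`, and `h1'`, `Wilkie1996ValRankTower.lean`).
[cite: WilkieJAMS1996, §§9–11] [cite: DenBesten2016, Theorems 7.1.22–7.1.23, 7.2.1 and Lemma 7.2.4] -/
theorem Wilkie1996_expPolynomialPoints_bounded_of_surjectivity (hMC : rexpTheory.IsModelComplete)
    (hS1 : ∀ K : Language.Theory.ModelType.{0, 0, 0} realExpTheory,
      IsPolynomiallyBounded Language.orderedERing K)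
    (hsurj : ∀ (M : Language.Theory.ModelType.{0, 0, 0} realExpTheory) (K k : Set M),
      definableClosure Language.orderedERing K = K →
      definableClosure Language.orderedERing k = k → k ⊆ K →
      ∀ (a : M), a ∈ K → 0 < a → (∀ n : ℕ, (n : M) * a < 1) →
      (∀ b ∈ K, 0 < b → ∃ q : ℕ, a ^ q < b) →
      (∀ b ∈ k, ∀ q : ℕ, |b| ^ q * a < 1) →
      (∀ b ∈ K, (∀ q : ℕ, |b| ^ q * a < 1) → ∃ b' ∈ k, b < b') →
      (∀ b ∈ K, (∀ q : ℕ, |b| ^ q * a < 1) → ∃ b₀ ∈ k, ∃ q : ℕ, |b - b₀| ^ (q + 1) ≤ a) →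
      ∀ (r : ℕ) (C : Fin r → M), (∀ i, C i ∈ K) → (∀ i, ∃ q : ℕ, |C i| ^ (q + 1) ≤ a) →
      K ⊆ definableClosure Language.orderedERing (k ∪ Set.range C) →
      ∀ d ∈ K, d ≠ 0 → (∃ q : ℕ, |d| ^ (q + 1) ≤ a) →
      ∃ α : M, (∃ p : Polynomial M, p ≠ 0 ∧
        (∀ n, p.coeff n ∈ Subring.closure (k ∪ Set.range C)) ∧ p.eval α = 0) ∧
        RealExpModel.IsVUnit (α / d)) :
    Wilkie1996_expPolynomialPoints_bounded :=
  Wilkie1996_expPolynomialPoints_bounded_of_absolute hMC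
    (AbsoluteInequality.absolute_of_surjectivity hMC hS1 hsurj)

/-- **Wilkie's theorem from the First Main Theorem, `S₁` for `T_e` and the surjectivity step.**
[cite: WilkieJAMS1996, Second Main Theorem and §§9–11] -/
theorem wilkie_isModelComplete_of_surjectivity (hMC : rexpTheory.IsModelComplete)
    (hS1 : ∀ K : Language.Theory.ModelType.{0, 0, 0} realExpTheory,
      IsPolynomiallyBounded Language.orderedERing K)
    (hsurj : ∀ (M : Language.Theory.ModelType.{0, 0, 0} realExpTheory) (K k : Set M),
      definableClosure Language.orderedERing K = K →
      definableClosure Language.orderedERing k = k → k ⊆ K →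
      ∀ (a : M), a ∈ K → 0 < a → (∀ n : ℕ, (n : M) * a < 1) →
      (∀ b ∈ K, 0 < b → ∃ q : ℕ, a ^ q < b) →
      (∀ b ∈ k, ∀ q : ℕ, |b| ^ q * a < 1) →
      (∀ b ∈ K, (∀ q : ℕ, |b| ^ q * a < 1) → ∃ b' ∈ k, b < b') →
      (∀ b ∈ K, (∀ q : ℕ, |b| ^ q * a < 1) → ∃ b₀ ∈ k, ∃ q : ℕ, |b - b₀| ^ (q + 1) ≤ a) →
      ∀ (r : ℕ) (C : Fin r → M), (∀ i, C i ∈ K) → (∀ i, ∃ q : ℕ, |C i| ^ (q + 1) ≤ a) →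
      K ⊆ definableClosure Language.orderedERing (k ∪ Set.range C) →
      ∀ d ∈ K, d ≠ 0 → (∃ q : ℕ, |d| ^ (q + 1) ≤ a) →
      ∃ α : M, (∃ p : Polynomial M, p ≠ 0 ∧
        (∀ n, p.coeff n ∈ Subring.closure (k ∪ Set.range C)) ∧ p.eval α = 0) ∧
        RealExpModel.IsVUnit (α / d)) :
    wilkie_isModelComplete :=
  wilkie_isModelComplete_of_expPolynomialPoints_bounded
    (Wilkie1996_expPolynomialPoints_bounded_of_surjectivity hMC hS1 hsurj)

/-- **`Wilkie1996_realExp_modelsExistentiallyClosed` from the First Main Theorem, `S₁` for `T_e`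
and the surjectivity step.** [cite: WilkieJAMS1996, §9, p. 1083] -/
theorem Wilkie1996_realExp_modelsExistentiallyClosed_of_surjectivity
    (hMC : rexpTheory.IsModelComplete)
    (hS1 : ∀ K : Language.Theory.ModelType.{0, 0, 0} realExpTheory,
      IsPolynomiallyBounded Language.orderedERing K)
    (hsurj : ∀ (M : Language.Theory.ModelType.{0, 0, 0} realExpTheory) (K k : Set M),
      definableClosure Language.orderedERing K = K →
      definableClosure Language.orderedERing k = k → k ⊆ K →
      ∀ (a : M), a ∈ K → 0 < a → (∀ n : ℕ, (n : M) * a < 1) →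
      (∀ b ∈ K, 0 < b → ∃ q : ℕ, a ^ q < b) →
      (∀ b ∈ k, ∀ q : ℕ, |b| ^ q * a < 1) →
      (∀ b ∈ K, (∀ q : ℕ, |b| ^ q * a < 1) → ∃ b' ∈ k, b < b') →
      (∀ b ∈ K, (∀ q : ℕ, |b| ^ q * a < 1) → ∃ b₀ ∈ k, ∃ q : ℕ, |b - b₀| ^ (q + 1) ≤ a) →
      ∀ (r : ℕ) (C : Fin r → M), (∀ i, C i ∈ K) → (∀ i, ∃ q : ℕ, |C i| ^ (q + 1) ≤ a) →
      K ⊆ definableClosure Language.orderedERing (k ∪ Set.range C) →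
      ∀ d ∈ K, d ≠ 0 → (∃ q : ℕ, |d| ^ (q + 1) ≤ a) →
      ∃ α : M, (∃ p : Polynomial M, p ≠ 0 ∧
        (∀ n, p.coeff n ∈ Subring.closure (k ∪ Set.range C)) ∧ p.eval α = 0) ∧
        RealExpModel.IsVUnit (α / d)) :
    Wilkie1996_realExp_modelsExistentiallyClosed :=
  Wilkie1996_realExp_modelsExistentiallyClosed_of_expPolynomialPoints_bounded
    (Wilkie1996_expPolynomialPoints_bounded_of_surjectivity hMC hS1 hsurj)

/-- **`Wilkie1996_expPolynomial_transfer` from the First Main Theorem, `S₁` for `T_e` and the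
surjectivity step.** [cite: WilkieJAMS1996, Second Main Theorem and §§9–11] -/
theorem Wilkie1996_expPolynomial_transfer_of_surjectivity (hMC : rexpTheory.IsModelComplete)
    (hS1 : ∀ K : Language.Theory.ModelType.{0, 0, 0} realExpTheory,
      IsPolynomiallyBounded Language.orderedERing K)
    (hsurj : ∀ (M : Language.Theory.ModelType.{0, 0, 0} realExpTheory) (K k : Set M),
      definableClosure Language.orderedERing K = K →
      definableClosure Language.orderedERing k = k → k ⊆ K →
      ∀ (a : M), a ∈ K → 0 < a → (∀ n : ℕ, (n : M) * a < 1) →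
      (∀ b ∈ K, 0 < b → ∃ q : ℕ, a ^ q < b) →
      (∀ b ∈ k, ∀ q : ℕ, |b| ^ q * a < 1) →
      (∀ b ∈ K, (∀ q : ℕ, |b| ^ q * a < 1) → ∃ b' ∈ k, b < b') →
      (∀ b ∈ K, (∀ q : ℕ, |b| ^ q * a < 1) → ∃ b₀ ∈ k, ∃ q : ℕ, |b - b₀| ^ (q + 1) ≤ a) →
      ∀ (r : ℕ) (C : Fin r → M), (∀ i, C i ∈ K) → (∀ i, ∃ q : ℕ, |C i| ^ (q + 1) ≤ a) →
      K ⊆ definableClosure Language.orderedERing (k ∪ Set.range C) →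
      ∀ d ∈ K, d ≠ 0 → (∃ q : ℕ, |d| ^ (q + 1) ≤ a) →
      ∃ α : M, (∃ p : Polynomial M, p ≠ 0 ∧
        (∀ n, p.coeff n ∈ Subring.closure (k ∪ Set.range C)) ∧ p.eval α = 0) ∧
        RealExpModel.IsVUnit (α / d)) :
    Wilkie1996_expPolynomial_transfer :=
  Wilkie1996_expPolynomial_transfer_of_expPolynomialPoints_bounded
    (Wilkie1996_expPolynomialPoints_bounded_of_surjectivity hMC hS1 hsurj)

/-- **The o-minimality of `ℝ_exp` from the First Main Theorem, `S₁` for `T_e` and the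
surjectivity step.** [cite: WilkieJAMS1996, §1] -/
theorem wilkie_isOMinimal_of_surjectivity (hMC : rexpTheory.IsModelComplete)
    (hS1 : ∀ K : Language.Theory.ModelType.{0, 0, 0} realExpTheory,
      IsPolynomiallyBounded Language.orderedERing K)
    (hsurj : ∀ (M : Language.Theory.ModelType.{0, 0, 0} realExpTheory) (K k : Set M),
      definableClosure Language.orderedERing K = K →
      definableClosure Language.orderedERing k = k → k ⊆ K →
      ∀ (a : M), a ∈ K → 0 < a → (∀ n : ℕ, (n : M) * a < 1) →
      (∀ b ∈ K, 0 < b → ∃ q : ℕ, a ^ q < b) →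
      (∀ b ∈ k, ∀ q : ℕ, |b| ^ q * a < 1) →
      (∀ b ∈ K, (∀ q : ℕ, |b| ^ q * a < 1) → ∃ b' ∈ k, b < b') →
      (∀ b ∈ K, (∀ q : ℕ, |b| ^ q * a < 1) → ∃ b₀ ∈ k, ∃ q : ℕ, |b - b₀| ^ (q + 1) ≤ a) →
      ∀ (r : ℕ) (C : Fin r → M), (∀ i, C i ∈ K) → (∀ i, ∃ q : ℕ, |C i| ^ (q + 1) ≤ a) →
      K ⊆ definableClosure Language.orderedERing (k ∪ Set.range C) →
      ∀ d ∈ K, d ≠ 0 → (∃ q : ℕ, |d| ^ (q + 1) ≤ a) →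
      ∃ α : M, (∃ p : Polynomial M, p ≠ 0 ∧
        (∀ n, p.coeff n ∈ Subring.closure (k ∪ Set.range C)) ∧ p.eval α = 0) ∧
        RealExpModel.IsVUnit (α / d)) :
    wilkie_isOMinimal :=
  wilkie_isOMinimal_of_expPolynomialPoints_bounded
    (Wilkie1996_expPolynomialPoints_bounded_of_surjectivity hMC hS1 hsurj)

end Literature.ModelTheory.ExponentialFields
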